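import Literature.NumberTheory.Automorphic.AsaiSignArchParityRankOne
import Literature.NumberTheory.Automorphic.BaseChangeArchimedeanCentralCharacter
import Literature.NumberTheory.Automorphic.ClozelPurityProofs
import Literature.NumberTheory.Automorphic.MokWeakBaseChange
import HarnessLib

/-!
# Mok's archimedean parity of the Asai sign read on the CENTRE: conjugate self-duality and
# standard base change of the central character, and the fact for odd `N`, `κ = +1`

Topic `NumberTheory/Automorphic`; namespace `Literature.NumberTheory.Automorphic`. Proof file
(theorems only: no definition, no named fact, no instance), sibling of `AsaiSign` (the named fact
`Mok2014_archimedean_parity_of_asaiSign`: C. P. Mok, Mem. AMS 235 (2015) no. 1108, Thm. 2.4.10 with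
Lemma 2.2.1, Remark 2.2.2 and Cor. 2.5.5, coset form), of `AsaiSignArchParityRankOne` (its `GL(1)`
stratum) and of `MokWeakBaseChange` (the named fact `Mok2014_standardBaseChange_descent`, Mok's
Thm. 2.4.2 / 2.5.4 (a) in the a.e. Satake interface).

## The idea: the determinant sees the parity when `N` is odd

In Mok's proof of Cor. 2.5.5 the archimedean parameter `φ_v = ⊕_i (z/z̄)^{a_i}` of a conjugate
self-dual cuspidal `Π` with sign `κ` is conjugate self-dual of parity `b = (-1)^{N-1} κ`
(Thm. 2.4.10 + Lemma 2.2.1), which pins `(-1)^{2 a_i} = b` entry by entry when the `a_i` are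
distinct ((2.2.6), Remark 2.2.2).  Its DETERMINANT `det φ_v = (z/z̄)^{∑ a_i}` is a conjugate
self-dual character of sign `b^N` (Gan–Gross–Prasad, §3), i.e. `(-1)^{2 ∑ a_i} = b^N`: for **odd `N`**
(where `b = κ`) and exponents in one coset `r + ℤ` this already reads `(-1)^{2r} = κ` — the
conclusion of the fact, with no regularity hypothesis — while for even `N` the centre is blind.
Automorphically the determinant is the CENTRAL CHARACTER `ω_Π`, and everything the argument needs
about it is proved in the tree or proved here:

* `AutomorphicRepData.centralCharacter_apply_smul_mul_eq_one_of_isConjSelfDualAE` — **`ω_Π` is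
  conjugate self-dual**, `ω_Π(c • y) ω_Π(y) = 1`: `ω_Π(ϖ_w) = ∏ t_{Π,w}` (the Satake shadow of the
  central character, `AutomorphicRepData.exists_centralCharacter`, Borel–Jacquet 5.7), conjugate
  self-duality a.e. `t_{Π, c w} = t_{Π, w}⁻¹`, and rigidity of Hecke characters
  (`HeckeCharacter.ext_of_eventually_valueAtUniformizer_eq`) — Mok §2.3, `(ψ^N)^* = ψ^N` read on
  the centre; the rank-one case is `apply_smul_mul_apply_eq_one_of_isConjSelfDualAE`.
* `AutomorphicRepData.restrict_centralCharacter_eq_one_of_isWeakBaseChange` — **the central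
  character of a standard weak base change from `U_{E/F}(N)` is trivial on `𝕀_F`**: at an inert
  place the standard base-change Satake parameter `{β_i} ∪ {1} ∪ {β_i⁻¹}` has product `1`
  (`UnitaryGroup.IsBaseChangeParam`, Mínguez 2011 Thm. 4.1 / Mok (2.1.9)), at a split place
  `ω(ϖ_v) = ∏ t_w · ∏ t_{c w} = ∏ t_w · (∏ t_w)⁻¹`, so `ω|_{𝕀_F}(ϖ_v) = 1` for almost all `v`, hence
  `ω|_{𝕀_F} = 1` (rigidity) — the centre of the standard base change (`ω_Π(x) = ω_π(x / x̄)`; Mok,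
  Thm. 2.4.2 with Thm. 2.5.4 (a) and the Remark following it, arXiv p. 21: `Π` "arises as standard
  base change from `U_{E/F}(N)` if and only if `L(s, Π, Asai^{(-1)^{N-1}})` has a pole at `s = 1`").
* `AutomorphicRepData.sum_archParameter_conjugate_and_centralCharacter_neg_one` — **the centre at a
  complex place `w` fixed by `c`**: if `ω(c • y) ω(y) = 1` then `∑ χ(σ̄_w) = -∑ χ(σ_w)` and
  `ω((-1)_w) = e^{2πi ∑ χ(σ_w)}` (the differential of `ω` is the central infinitesimal character,
  `centralCharacter_det_ofInfinite_expGL` and `HasArchParameter.lieDeriv_scalar_sub_smul_mem`; `c`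
  conjugates the exponential idèles at `w`, `smul_det_ofInfinite_expGL_complexPlace_of_ne_one`).
* `CuspidalAutomorphicRepData.archParameter_conjugate_eq_map_neg_conj_of_isConjSelfDualAE` —
  **Clozel's Hermitian symmetry with shift `0`**: for a conjugate self-dual cuspidal `Π` (granted a
  complex place of `E` fixed by `c`), `χ(ῑ) = {-ā : a ∈ χ(ι)}` at every `ι`
  (`archParameter_conjugate_eq_map_neg_conj_add`, Clozel's Lemme 4.9, gives this up to a real
  shift, which the centre forces to vanish).
* `Mok2014_archimedean_parity_of_asaiSign_odd_pos_of_isWeakBaseChange` (**main**) — for odd `N`, a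
  conjugate self-dual cuspidal `P` on `GL_N(𝔸_E)` which is a standard weak base change from
  `U_{E/F}(N)` and has an infinity type (`AutomorphicRepData.exists_hasInfinityType`, Clozel 1990
  §3.3: an integral pairing of the exponents at `σ` and `σ̄`), and `σ` on which `c` is complex
  conjugation: if the exponents `χ σ` lie in one real coset `r + ℤ` then they are INTEGERS, i.e. lie
  in `(N-1)/2 + (1-κ)/4 + ℤ` with `κ = +1` — no regularity (`Nodup`) hypothesis;
  `Mok2014_archimedean_parity_of_asaiSign_odd_pos_of_standardBaseChange_descent` — hence **the
  stratum `N` odd, `κ = +1` of `Mok2014_archimedean_parity_of_asaiSign` follows from the named fact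
  `Mok2014_standardBaseChange_descent`** (whose hypotheses `IsConjSelfDualAE`, `HasAsaiSign c 1` are
  exactly those of the fact at `κ = 1`, raw currency included) and the existence of infinity types;
  `CuspidalAutomorphicRepData.not_isWeakBaseChange_of_odd_of_coset`,
  `….not_hasAsaiSign_one_of_odd_of_coset` — the currency-free contrapositive: for odd `N`, exponents
  in `r + ℤ` with `r ∉ ℤ` (e.g. `r = 1/2`) exclude a standard weak base change (hence, with Mok's
  Thm. 2.4.2 in any currency, pin `κ = -1`);
  `Mok2014_archimedean_parity_of_asaiSign_odd_pos_of_isWeakBaseChange_of_two_mul`,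
  `….not_isWeakBaseChange_of_odd_of_mem_half`, `….not_hasAsaiSign_one_of_odd_of_mem_half` — the same
  WITHOUT an infinity type, asking only `2r ∈ ℤ` (all the integral pairing was used for; automatic for
  exponents in `1/2 + ℤ`): for odd `N`, half-integral non-integral exponents at a `c`-conjugation place
  exclude a standard weak base change from `U_{E/F}(N)`;
  `AutomorphicRepData.sum_archParameter_int_or_half_of_isConjSelfDualAE` — unconditionally (no base
  change, no infinity type): `ω|_{𝕀_F}` is trivial on the norm group (hence `∈ {1, ω_{E/F}}`), and
  `∑ χ(σ) ∈ ℤ` if `ω|_{𝕀_F} = 1`, `∑ χ(σ) ∈ 1/2 + ℤ` if not (`e^{2πi ∑ χ(σ)} = ω|_{𝕀_F, v}(-1)` and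
  `ω_{E/F, v}(-1) = -1`).

Arithmetic of the last step: `∑ χ(σ) ∈ ℤ` (from `ω|_{𝕀_F} = 1` at `(-1)_v`), `2r ∈ ℤ` (an exponent
`a ∈ r + ℤ` is paired with some `b`, `a - b ∈ ℤ`, and `b ∈ χ(σ̄) = -χ(σ) ⊆ -r + ℤ`), `N r ∈ ℤ`
(`∑ χ(σ) = N r +` integer), and `r = N r - ((N-1)/2)(2r)` for odd `N`.

What this does NOT give: `κ = -1` for odd `N` (it needs the twisted descent `ξ_{χ_-}`, not vendored
in `MokWeakBaseChange`, or the twist `Π ⊗ μ`, `μ|_{𝕀_F} = ω_{E/F}`); anything for even `N` (there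
`ω|_{𝕀_F}` and `(-1)^{2 ∑ a_i}` are `1` for both signs); and the inputs `Mok2014_standardBaseChange_descent`
(Mok's Thm. 2.4.2, the trace formula) and `exists_hasInfinityType` (Harish-Chandra / Langlands
classification at the complex places), named facts of the tree.

## References

* C. P. Mok, *Endoscopic classification of representations of quasi-split unitary groups*,
  Mem. Amer. Math. Soc. 235 (2015), no. 1108 = arXiv:1206.0882: §2.1 (2.1.9) (`ξ_{χ_κ}`), Lemma
  2.2.1 and Remark 2.2.2 (p. 8), §2.3 (`(ψ^N)^*`, p. 11), Thm. 2.4.2, Thm. 2.4.10 (p. 16), Thm. 2.5.4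
  and Cor. 2.5.5 (pp. 20–21). [Mok2014]
* W. T. Gan, B. Gross, D. Prasad, *Symplectic local root numbers, central critical `L`-values, and
  restriction problems*, Astérisque 346 (2012) = arXiv:0909.2999, §3: "If `M` is conjugate-dual via a
  pairing `B` with sign `b = ±1`, then `det(M)` is conjugate-dual with sign `= (b)^{dim(M)}`" (paragraph
  before Lemma 3.4), and Lemma 3.4 (`ℂ(χ)` is conjugate-orthogonal iff `χ|_{k₀ˣ} = 1`, conjugate-symplectic
  iff `χ` is non-trivial on `k₀ˣ` but trivial on `N kˣ`); read: `lit read arxiv:0909.2999`, p. 7.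
  [GanGrossPrasad2012]
* A. Mínguez, *Unramified representations of unitary groups*, in: On the stabilization of the
  trace formula (2011), Thm. 4.1. [Minguez2011]
* L. Clozel, *Motifs et formes automorphes*, in Automorphic forms, Shimura varieties, and
  L-functions I (1990), §3.3 and Lemme 4.9. [Clozel1990]
* A. Borel, H. Jacquet, *Automorphic forms and automorphic representations*, Corvallis 1979, §4.6
  and 5.7. [BorelJacquetCorvallis1979]
* J. W. S. Cassels, A. Fröhlich (eds.), *Algebraic Number Theory* (1967), Ch. VII (Tate), §4,
  Prop. 4.1 (rigidity of Hecke characters). [CasselsFrohlichANT1967]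
-/

noncomputable section

open scoped MatrixGroups Matrix Classical NumberField ComplexConjugate
open NumberField NumberField.InfinitePlace NumberField.mixedEmbedding IsDedekindDomain Filter

namespace Literature.NumberTheory.Automorphic

open Literature.NumberTheory.GaloisRepresentations

/-! ### The central character of a conjugate self-dual representation is conjugate self-dual -/

section CentreConjSelfDual

variable {F E : Type} [Field F] [NumberField F] [Field E] [NumberField E] [Algebra F E]
  {N : ℕ} {hcpt : isCompact_glFiniteIntegralLevel N E}

omit [NumberField F] in
/-- **The central character of a conjugate self-dual automorphic representation of `GL_N(𝔸_E)` is
conjugate self-dual: `ω(c • y) ω(y) = 1`.**  Here `ω` is a Hecke character carrying the Satake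
shadow of the central character of `π = W / W'` (`ω` unramified with `ω(ϖ_w) = ∏ α` wherever `π` has
Satake parameter `α` at `w`, `AutomorphicRepData.exists_centralCharacter`).  At almost every `w`,
`π` is unramified at `w` and `c • w` (Flath, `hasSatakeParamAt_cofinite_holds`) with
`t_{c • w} = t_w⁻¹` (`IsConjSelfDualAE`), so `(ω ∘ c)(ϖ_w) ω(ϖ_w) = ∏ t_w⁻¹ · ∏ t_w = 1`; and a Hecke
character is determined by almost all of its values at uniformizers.  (Mok, §2.3 p. 11: `Π` conjugate
self-dual, `(ψ^N)^* = ψ^N`, read on the central character; the `GL(1)` case is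
`apply_smul_mul_apply_eq_one_of_isConjSelfDualAE`.) [cite: Mok2014, §2.3, arXiv p. 11]
[cite: CasselsFrohlichANT1967, Ch. VII §4 Prop. 4.1 (proof)] -/
theorem AutomorphicRepData.centralCharacter_apply_smul_mul_eq_one_of_isConjSelfDualAE
    (π : AutomorphicRepData (AutomorphyDatum.gl N E hcpt)) {ω : HeckeCharacter E}
    (hω : ∀ {w : HeightOneSpectrum (𝓞 E)} {α : Multiset ℂ}, π.HasSatakeParamAt w α →
      ω.IsUnramifiedAt w ∧ ω.valueAtUniformizer w = α.prod)
    {c : E ≃ₐ[F] E} (hcsd : π.IsConjSelfDualAE c) (y : ideleGroup E) : ω (c • y) * ω y = 1 := by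
  obtain ⟨ωc, hωc⟩ := ω.exists_galConj c
  have hone : ωc * ω = 1 := by
    refine HeckeCharacter.ext_of_eventually_valueAtUniformizer_eq ?_
    have hsat : ∀ᶠ w : HeightOneSpectrum (𝓞 E) in cofinite, π.IsUnramifiedAt w :=
      π.hasSatakeParamAt_cofinite_holds
    have hinj : Function.Injective fun w : HeightOneSpectrum (𝓞 E) => c • w := MulAction.injective c
    have hsat' := hinj.tendsto_cofinite.eventually hsat
    filter_upwards [hcsd, hsat, hsat'] with w hw hs hs'
    obtain ⟨α, hα⟩ := hs
    obtain ⟨β, hβ⟩ := hs'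
    have key : β = α.map (·⁻¹) := hw α β hα hβ
    obtain ⟨-, hvalw⟩ := hω hα
    obtain ⟨hurcw, hvalcw⟩ := hω hβ
    have hne : α.prod ≠ 0 := by
      rw [← hvalw, HeckeCharacter.valueAtUniformizer]
      exact Units.ne_zero _
    have h1 : (1 : HeckeCharacter E).valueAtUniformizer w = 1 := by
      rw [HeckeCharacter.valueAtUniformizer, HeckeCharacter.localComponent_apply,
        HeckeCharacter.one_apply, Units.val_one]
    rw [HeckeCharacter.valueAtUniformizer_mul, HeckeCharacter.valueAtUniformizer_galConj hωc hurcw,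
      hvalcw, key, Multiset.prod_map_inv, Multiset.map_id', hvalw, inv_mul_cancel₀ hne, h1]
  have h := congrArg (fun χ : HeckeCharacter E => χ y) hone
  simpa only [HeckeCharacter.mul_apply, hωc, HeckeCharacter.one_apply] using h

end CentreConjSelfDual

/-! ### The central character of a standard weak base change from `U_{E/F}(N)` is trivial on `𝕀_F` -/

section CentreBaseChange

variable {F E : Type} [Field F] [NumberField F] [Field E] [NumberField E] [Algebra F E]
  {N : ℕ} {hcpt : isCompact_glFiniteIntegralLevel N E}

omit [NumberField F] [NumberField E] in
/-- **The product of a standard base-change Satake parameter at a `c`-fixed place is `1`.**  For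
torus parameters `β` satisfying the base-change constraint at `w = c • w`
(`UnitaryGroup.IsBaseChangeParam`: `β_{N-1-i} = β_i⁻¹`, and the middle parameter is `1` for odd `N`),
`∏_i β_i = 1` (pair `i` with `N - 1 - i`).  Mínguez 2011, Thm. 4.1; Mok, §2.1 (2.1.9): the standard
base change of an unramified parameter `t ⋊ Frob_v` is `t · Φ_N ᵗt⁻¹ Φ_N⁻¹`, of determinant `1`.
[cite: Minguez2011, Thm. 4.1] [cite: Mok2014, §2.1 (2.1.9)] -/
theorem UnitaryGroup.IsBaseChangeParam.prod_eq_one {c : E ≃ₐ[F] E} {w : HeightOneSpectrum (𝓞 E)}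
    {β : Fin N → ℂ} (h : UnitaryGroup.IsBaseChangeParam F E c N w β) (hw : c • w = w) :
    ∏ i, β i = 1 := by
  obtain ⟨h0, hc⟩ := h
  have hrev := hc hw
  refine Finset.prod_ninvolution Fin.rev (fun i => ?_) (fun i hi => ?_) (fun i => Finset.mem_univ _)
    (fun i => Fin.rev_rev i)
  · rw [(hrev i).1, mul_inv_cancel₀ (h0 i)]
  · exact fun e => hi ((hrev i).2 e)

/-- **The central character of a conjugate self-dual standard weak base change from `U_{E/F}(N)` is
trivial on `𝕀_F`.**  Let `P = W / W'` be an automorphic representation of `GL_N(𝔸_E)` (`E/F`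
quadratic, `c ≠ 1`), conjugate self-dual almost everywhere, which is a weak base change of an
automorphic representation `π` of `U_{E/F}(N)(𝔸_F)` for the standard embedding `ξ_1`
(`UnitaryGroup.IsWeakBaseChange`), `ω` a Hecke character carrying the Satake shadow of its central
character, and `ψ = ω|_{𝕀_F}`.  Then `ψ = 1`: for almost every finite place `v` of `F` (all places
above `v` unramified for `P`, for `E/F` and good for both a.e. hypotheses), `ψ(ϖ_v) = ∏_{w ∣ v} ω(ϖ_w)`
(`HeckeCharacter.valueAtUniformizer_restrict`) equals `∏_i β_i = 1` at an inert `v`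
(`IsBaseChangeParam.prod_eq_one`) and `∏ t_w · ∏ t_w⁻¹ = 1` at a split one, and a Hecke character is
determined by almost all `ψ(ϖ_v)`.  This is the centre of the standard base change (standard base
change `⇒` `ω_Π` trivial on `𝔸_F^×`), in the a.e. Satake interface of `MokWeakBaseChange` (Mok, Thm.
2.4.2 and the Remark after Thm. 2.5.4, arXiv p. 21; §4.3 Cor. 4.3.8, "weak base change").
[cite: Mok2014, Thm. 2.4.2, Remark after Thm. 2.5.4 (arXiv p. 21) and §4.3 Cor. 4.3.8] [cite: Minguez2011, Thm. 4.1]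
[cite: CasselsFrohlichANT1967, Ch. VII §4 Prop. 4.1 (proof)] -/
theorem AutomorphicRepData.restrict_centralCharacter_eq_one_of_isWeakBaseChange
    (h2 : Module.finrank F E = 2) {c : E ≃ₐ[F] E} (hc : c ≠ 1)
    (P : AutomorphicRepData (AutomorphyDatum.gl N E hcpt)) {ω : HeckeCharacter E}
    (hω : ∀ {w : HeightOneSpectrum (𝓞 E)} {α : Multiset ℂ}, P.HasSatakeParamAt w α →
      ω.IsUnramifiedAt w ∧ ω.valueAtUniformizer w = α.prod)
    (hcsd : P.IsConjSelfDualAE c) {π : UnitaryGroupAutomorphicRep F E c N hcpt}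
    (hBC : UnitaryGroup.IsWeakBaseChange F E c N hcpt P π)
    {ψ : HeckeCharacter F} (hψ : ∀ x, ψ x = ω (AdeleRing.ideleBaseChange F E x)) : ψ = 1 := by
  haveI : Algebra.IsQuadraticExtension F E := ⟨h2⟩
  haveI : IsGalois F E := inferInstance
  refine HeckeCharacter.ext_of_eventually_valueAtUniformizer_eq ?_
  -- the good places of `E`
  have hgoodE : ∀ᶠ w : HeightOneSpectrum (𝓞 E) in cofinite,
      P.IsUnramifiedAt w ∧
        (∀ α β : Multiset ℂ, P.HasSatakeParamAt w α → P.HasSatakeParamAt (c • w) β →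
          β = α.map (·⁻¹)) ∧
        (∀ α : Multiset ℂ, UnitaryGroup.HasBaseChangeSatakeAt F E c N hcpt π w α ↔
          P.HasSatakeParamAt w α) ∧
        w.asIdeal.ramificationIdx (𝓞 F) = 1 := by
    filter_upwards [P.hasSatakeParamAt_cofinite_holds, hcsd, hBC, eventually_ramificationIdx_eq_one F E]
      with w h1 h2' h3 h4
    exact ⟨h1, h2', h3, h4⟩
  -- transferred to the places of `F`
  have hgoodF : ∀ᶠ v : HeightOneSpectrum (𝓞 F) in cofinite, ∀ w : HeightOneSpectrum (𝓞 E),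
      w.under (𝓞 F) = v →
        P.IsUnramifiedAt w ∧
          (∀ α β : Multiset ℂ, P.HasSatakeParamAt w α → P.HasSatakeParamAt (c • w) β →
            β = α.map (·⁻¹)) ∧
          (∀ α : Multiset ℂ, UnitaryGroup.HasBaseChangeSatakeAt F E c N hcpt π w α ↔
            P.HasSatakeParamAt w α) ∧
          w.asIdeal.ramificationIdx (𝓞 F) = 1 := by
    rw [Filter.eventually_cofinite] at hgoodE ⊢
    refine (hgoodE.image fun w : HeightOneSpectrum (𝓞 E) => w.under (𝓞 F)).subset ?_
    intro v hv
    simp only [Set.mem_setOf_eq, not_forall] at hv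
    obtain ⟨w, hwv, hw⟩ := hv
    exact ⟨w, hw, hwv⟩
  filter_upwards [hgoodF] with v hv
  have h1v : (1 : HeckeCharacter F).valueAtUniformizer v = 1 := by
    rw [HeckeCharacter.valueAtUniformizer, HeckeCharacter.localComponent_apply,
      HeckeCharacter.one_apply, Units.val_one]
  rw [h1v]
  -- the places above `v`: `w₀` and `c • w₀`
  set w₀ := placeAbove E v with hw₀
  have hw₀v : w₀.under (𝓞 F) = v := placeAbove_under v
  have hcw₀v : (c • w₀).under (𝓞 F) = v := (HeightOneSpectrum.under_algEquiv_smul F E c w₀).trans hw₀v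
  have he : ∀ w : HeightOneSpectrum (𝓞 E), w.under (𝓞 F) = v → w.asIdeal.ramificationIdx (𝓞 F) = 1 :=
    fun w hw => (hv w hw).2.2.2
  have hunr : ∀ w : HeightOneSpectrum (𝓞 E), w.under (𝓞 F) = v → ω.IsUnramifiedAt w := by
    intro w hw
    obtain ⟨α, hα⟩ := (hv w hw).1
    exact (hω hα).1
  rw [HeckeCharacter.valueAtUniformizer_restrict hψ _ (HeightOneSpectrum.mem_pair_placeAbove_iff h2 hc v)
    he hunr]
  obtain ⟨⟨α, hα⟩, hdual, hbc, -⟩ := hv w₀ hw₀v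
  have hvalw : ω.valueAtUniformizer w₀ = α.prod := (hω hα).2
  by_cases hfix : c • w₀ = w₀
  · -- inert: `α = {β_i}` with the base-change constraint, `∏ β_i = 1`
    rw [← hw₀, hfix, Finset.insert_eq_of_mem (Finset.mem_singleton_self _), Finset.prod_singleton,
      hvalw]
    obtain ⟨-, β, -, -, -, hβ, rfl, -⟩ := (hbc α).2 hα
    rw [← Finset.prod_eq_multiset_prod]
    exact UnitaryGroup.IsBaseChangeParam.prod_eq_one hβ hfix
  · -- split: `∏ t_{w₀} · ∏ t_{c • w₀} = ∏ t_{w₀} · (∏ t_{w₀})⁻¹`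
    have hne : w₀ ≠ c • w₀ := fun h => hfix h.symm
    rw [← hw₀, Finset.prod_pair hne, hvalw]
    obtain ⟨αc, hαc⟩ := (hv (c • w₀) hcw₀v).1
    rw [(hω hαc).2, hdual α αc hα hαc, Multiset.prod_map_inv, Multiset.map_id']
    have hne0 : α.prod ≠ 0 := by
      rw [← hvalw, HeckeCharacter.valueAtUniformizer]
      exact Units.ne_zero _
    exact mul_inv_cancel₀ hne0

end CentreBaseChange


/-! ### The centre at a complex place fixed by `c`: `∑ χ(σ̄_w) = -∑ χ(σ_w)`, `ω((-1)_w) = e^{2πi ∑ χ(σ_w)}` -/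

section CentreArch

variable {F E : Type} [Field F] [NumberField F] [Field E] [NumberField E] [Algebra F E]
  {N : ℕ} {hcpt : isCompact_glFiniteIntegralLevel N E}

omit [NumberField F] in
/-- **The centre of a conjugate self-dual representation at a complex place `w` fixed by `c`.**
Let `P = W / W'` be an automorphic representation of `GL_N(𝔸_E)` with archimedean parameter `χ`,
`ω` a Hecke character through which the centre `Z(𝔸_E)` acts on `W / W'`
(`AutomorphicRepData.exists_centralCharacter`) with `ω(c • y) ω(y) = 1`, and `w` a complex place of
`E` with `c • w = w` (`c ≠ 1`).  Then, with `p = ∑ χ(σ_w)` and `q = ∑ χ(σ̄_w)`: **`q = -p`** and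
**`ω((-1)_w) = e^{2πi p}`**.  The centre `x · 1_N ∈ 𝔤` acts by the linear form `d` with
`d(a_w) = a p + ā q` (`HasArchParameter.lieDeriv_scalar_sub_smul_mem`) and `ω(det(exp a_w, 1)) =
e^{d(a_w)}` (`centralCharacter_det_ofInfinite_expGL`); `c` conjugates the exponential idèles at `w`
(`smul_det_ofInfinite_expGL_complexPlace_of_ne_one`), so conjugate self-duality along `a = t ∈ ℝ`
gives `e^{2t(p+q)} = 1`, `p + q = 0`; and `(-1)_w = det(exp (iπ)_w, 1)` gives
`ω((-1)_w) = e^{iπ(p - q)} = e^{2πi p}`.  (Mok §2.1 p. 7, (2.1.8) `χ_κ(w_c²) = κ` at the archimedean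
place `w_c = j`, `j² = -1`, for the determinant character; the `GL(1)` case is
`glOne_archParam_of_conjSelfDual`.) [cite: Mok2014, §2.1 (2.1.4)–(2.1.8), arXiv p. 7]
[cite: Clozel1990, §3.3] [cite: BorelJacquetCorvallis1979, 5.7] -/
theorem AutomorphicRepData.sum_archParameter_conjugate_and_centralCharacter_neg_one
    {c : E ≃ₐ[F] E} (hc : c ≠ 1)
    (P : AutomorphicRepData (AutomorphyDatum.gl N E hcpt)) {ω : HeckeCharacter E}
    (hωc : ∀ (z : ideleGroup E), ∀ φ ∈ P.W, rightTranslation (AdelicGroupData.gl N E)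
      (Matrix.GeneralLinearGroup.scalar (Fin N) z) φ - ((ω z : ℂˣ) : ℂ) • φ ∈ P.W')
    (hdual : ∀ y : ideleGroup E, ω (c • y) * ω y = 1)
    {χ : (E →+* ℂ) → Multiset ℂ} (hχ : P.HasArchParameter χ)
    (w : {w : InfinitePlace E // w.IsComplex}) (hcw : c • w.1 = w.1) :
    (χ (ComplexEmbedding.conjugate w.1.embedding)).sum = -(χ w.1.embedding).sum ∧
      ((ω (infiniteIdeleSingle w.1 (-1)) : ℂˣ) : ℂ) =
        Complex.exp (2 * Real.pi * Complex.I * (χ w.1.embedding).sum) := by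
  -- the central infinitesimal character `d`, evaluated by the archimedean parameter
  obtain ⟨d, hd⟩ := P.exists_linearMap_lieDeriv_scalar_sub_smul_mem
  have hdx : ∀ x : mixedSpace E, d x =
      ∑ w' : {w : InfinitePlace E // IsReal w}, (x.1 w' : ℂ) * (χ w'.1.embedding).sum +
        ∑ w' : {w : InfinitePlace E // IsComplex w},
          (x.2 w' * (χ w'.1.embedding).sum +
            conj (x.2 w') * (χ (ComplexEmbedding.conjugate w'.1.embedding)).sum) := fun x =>
    P.sub_smul_mem_unique (hd x) (fun φ hφ => hχ.lieDeriv_scalar_sub_smul_mem x hφ)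
  set p : ℂ := (χ w.1.embedding).sum with hp
  set q : ℂ := (χ (ComplexEmbedding.conjugate w.1.embedding)).sum with hq
  -- `ω(det (exp a_w, 1)) = e^{a p + ā q}`
  have hval : ∀ a : ℂ, ((ω (Matrix.GeneralLinearGroup.det (GLn.ofInfinite 1 E
      (expGL (complexPlaceLie 1 w (a • (1 : Matrix (Fin 1) (Fin 1) ℂ)))))) : ℂˣ) : ℂ) =
        Complex.exp (a * p + conj a * q) := fun a => by
    rw [P.centralCharacter_det_ofInfinite_expGL hωc hd, hdx, sum_places_complexPlaceLie_entry]
  -- `p + q = 0`: `c` conjugates the exponential idèles at `w`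
  have hpq : p + q = 0 := by
    have key : (2 : ℂ) * (p + q) = 0 := by
      refine eq_of_forall_cexp_mul_eq fun t => ?_
      have h := congrArg (fun u : ℂˣ => (u : ℂ)) (hdual (Matrix.GeneralLinearGroup.det
        (GLn.ofInfinite 1 E (expGL (complexPlaceLie 1 w ((t : ℂ) • (1 : Matrix (Fin 1) (Fin 1) ℂ)))))))
      rw [Units.val_mul, Units.val_one, smul_det_ofInfinite_expGL_complexPlace_of_ne_one F E w hcw hc,
        hval, hval, Complex.conj_conj, Complex.conj_ofReal, ← Complex.exp_add] at h
      rw [mul_zero, Complex.exp_zero, ← h]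
      congr 1
      ring
    exact (mul_eq_zero.1 key).resolve_left two_ne_zero
  refine ⟨by linear_combination hpq, ?_⟩
  -- `(-1)_w = det (exp (iπ)_w, 1)`, so `ω((-1)_w) = e^{iπ (p - q)} = e^{2πi p}`
  have hidele : infiniteIdeleSingle w.1 (-1) = Matrix.GeneralLinearGroup.det (GLn.ofInfinite 1 E
      (expGL (complexPlaceLie 1 w (((Real.pi : ℂ) * Complex.I) • (1 : Matrix (Fin 1) (Fin 1) ℂ))))) := by
    refine idele_eq_of_snd_eq_of_extensionEmbedding_eq E ?_ fun w' => ?_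
    · rw [det_ofInfinite_snd, infiniteIdeleSingle_snd]
    · rw [extensionEmbedding_det_ofInfinite_expGL_complexPlaceLie]
      by_cases h : w' = w.1
      · rw [if_pos h, h, infiniteIdeleSingle_fst_self, Units.val_neg, Units.val_one, map_neg, map_one,
          Complex.exp_pi_mul_I]
      · rw [if_neg h, infiniteIdeleSingle_fst_of_ne _ h, map_one]
  rw [hidele, hval, map_mul, Complex.conj_ofReal, Complex.conj_I]
  congr 1
  linear_combination (-((Real.pi : ℂ) * Complex.I)) * hpq

/-- **An archimedean parameter on `GL_N` has `N` entries at every complex embedding** (a local copy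
of `AutomorphicRepData.card_eq_of_hasArchParameter` of `KimExteriorSquareGL4ArchimedeanTwist`, to keep
the imports light: `σ` is `σ_w` or `σ̄_w` for its place `w`, and Harish-Chandra parameters of
`𝔤𝔩_N(K_w)`-modules have `N` entries). Clozel 1990, §3.3. [cite: Clozel1990, §3.3] -/
private theorem card_eq_of_hasArchParameter' {π : AutomorphicRepData (AutomorphyDatum.gl N E hcpt)}
    {χ : (E →+* ℂ) → Multiset ℂ} (h : π.HasArchParameter χ) (σ : E →+* ℂ) :
    Multiset.card (χ σ) = N := by
  obtain ⟨ρ, -, hre, hco⟩ := h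
  rcases (InfinitePlace.mk σ).isReal_or_isComplex with hw | hw
  · have h1 := (hre ⟨InfinitePlace.mk σ, hw⟩).1 (Algebra.ofId ℝ ℂ)
    dsimp only at h1
    rwa [embedding_mk_eq_of_isReal (isReal_mk_iff.mp hw)] at h1
  · rcases InfinitePlace.mk_eq_iff.mp (InfinitePlace.mk_embedding (InfinitePlace.mk σ)) with hσ | hσ
    · have h1 := (hco ⟨InfinitePlace.mk σ, hw⟩).1 (AlgHom.id ℝ ℂ)
      dsimp only at h1
      rwa [algHomId_toRingHom_comp, hσ] at h1
    · have h1 := (hco ⟨InfinitePlace.mk σ, hw⟩).1 (Complex.conjAe : ℂ →ₐ[ℝ] ℂ)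
      dsimp only at h1
      rwa [conjAe_toRingHom_comp, hσ] at h1

omit [NumberField F] in
/-- **Clozel's Hermitian symmetry has shift `0` for a conjugate self-dual cuspidal representation**:
for a cuspidal `P` on `GL_N(𝔸_E)` (`N ≥ 1`) conjugate self-dual almost everywhere, with archimedean
parameter `χ`, and granted a complex place `w` of `E` fixed by `c ≠ 1` (e.g. the place of an
embedding on which `c` is complex conjugation): `χ(ῑ) = {-ā : a ∈ χ(ι)}` at EVERY embedding `ι`.  By
`CuspidalAutomorphicRepData.archParameter_conjugate_eq_map_neg_conj_add` (Clozel's lemme de pureté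
4.9 on multisets: unitarity of `P_∞ ⊗ |det|^{c₀/2}`) there is a real `c₀` with
`χ(ῑ) = {-ā + c₀}` for all `ι`; summing at `ι = σ_w` and comparing with `∑ χ(σ̄_w) = -∑ χ(σ_w)`
(`sum_archParameter_conjugate_and_centralCharacter_neg_one`, fed by the conjugate self-dual central
character) gives `N c₀ = \bar p - p ∈ iℝ`, so `c₀ = 0`.  (Mok §2.3: a conjugate self-dual `Π` is
unitary, `(Π^c)^∨ ≅ Π`, read on the infinitesimal characters at `w`.)
[cite: Clozel1990, Lemme 4.9] [cite: Mok2014, §2.3, arXiv p. 11] -/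
theorem CuspidalAutomorphicRepData.archParameter_conjugate_eq_map_neg_conj_of_isConjSelfDualAE
    [NeZero N] {c : E ≃ₐ[F] E} (hc : c ≠ 1) (P : CuspidalAutomorphicRepData N E hcpt)
    (hcsd : P.1.IsConjSelfDualAE c) {χ : (E →+* ℂ) → Multiset ℂ} (hχ : P.1.HasArchParameter χ)
    (w : {w : InfinitePlace E // w.IsComplex}) (hcw : c • w.1 = w.1) (ι : E →+* ℂ) :
    χ (ComplexEmbedding.conjugate ι) = (χ ι).map fun a => -conj a := by
  obtain ⟨c₀, hc₀⟩ := P.archParameter_conjugate_eq_map_neg_conj_add hχ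
  -- the centre at `w`
  obtain ⟨ω, hωc, hωs⟩ := P.1.exists_centralCharacter
  have hdual : ∀ y : ideleGroup E, ω (c • y) * ω y = 1 :=
    P.1.centralCharacter_apply_smul_mul_eq_one_of_isConjSelfDualAE (fun h => hωs h) hcsd
  obtain ⟨hsum, -⟩ :=
    P.1.sum_archParameter_conjugate_and_centralCharacter_neg_one hc hωc hdual hχ w hcw
  -- Clozel's identity summed at `σ_w`: `∑ χ(σ̄_w) = -conj (∑ χ(σ_w)) + N c₀`
  have hcard : Multiset.card (χ w.1.embedding) = N := card_eq_of_hasArchParameter' hχ _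
  have hsum' : (χ (ComplexEmbedding.conjugate w.1.embedding)).sum =
      -conj (χ w.1.embedding).sum + (N : ℂ) * c₀ := by
    rw [hc₀, Multiset.sum_map_add, Multiset.sum_map_neg, map_multiset_sum, Multiset.map_const',
      Multiset.sum_replicate, hcard, nsmul_eq_mul]
  -- real parts: `N c₀ = 0`
  have hc₀0 : c₀ = 0 := by
    have h := congrArg Complex.re (hsum.symm.trans hsum')
    simp only [Complex.neg_re, Complex.add_re, Complex.conj_re, Complex.mul_re, Complex.natCast_re,
      Complex.natCast_im, Complex.ofReal_re, Complex.ofReal_im, mul_zero, sub_zero] at h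
    have hN : (N : ℝ) ≠ 0 := Nat.cast_ne_zero.2 (NeZero.ne N)
    have : (N : ℝ) * c₀ = 0 := by linarith
    exact (mul_eq_zero.1 this).resolve_left hN
  rw [hc₀ ι, hc₀0, Complex.ofReal_zero]
  simp only [add_zero]

end CentreArch

/-! ### The fact for odd `N` and `κ = +1` -/

section OddPositive

variable {F E : Type} [Field F] [NumberField F] [Field E] [NumberField E] [Algebra F E]
  {N : ℕ} {hcpt : isCompact_glFiniteIntegralLevel N E}

/-- A multiset of (complex numbers that are) integers has an integer sum. [folklore] -/
private theorem exists_int_multiset_sum {S : Multiset ℂ} (h : ∀ x ∈ S, ∃ m : ℤ, x = m) :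
    ∃ M : ℤ, S.sum = M := by
  induction S using Multiset.induction_on with
  | empty => exact ⟨0, by simp⟩
  | cons a S ih =>
    obtain ⟨m, hm⟩ := h a (Multiset.mem_cons_self a S)
    obtain ⟨M, hM⟩ := ih fun x hx => h x (Multiset.mem_cons_of_mem hx)
    exact ⟨m + M, by rw [Multiset.sum_cons, hm, hM, Int.cast_add]⟩

/-- **Mok's archimedean parity of the Asai sign for odd `N` along a standard weak base change — the
centre of Cor. 2.5.5.**  Let `E/F` be quadratic with non-trivial automorphism `c`, `N` odd, `P` a
cuspidal automorphic representation datum of `GL_N(𝔸_E)` which is conjugate self-dual almost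
everywhere, is a weak base change of an automorphic representation `π` of `U_{E/F}(N)(𝔸_F)` for the
STANDARD embedding `ξ_1` (`UnitaryGroup.IsWeakBaseChange`; by Mok's Thm. 2.4.2 / 2.5.4 this is the
case `κ = +1`) and admits an infinity type (`AutomorphicRepData.exists_hasInfinityType`, Clozel 1990
§3.3), let `χ` be its archimedean parameter and `σ : E → ℂ` an embedding on which `c` is complex
conjugation.  If the exponents `χ σ` all lie in one real coset `r + ℤ`, then they are all INTEGERS —
i.e. lie in `(N-1)/2 + ℤ`, the conclusion of `Mok2014_archimedean_parity_of_asaiSign` at `κ = +1`; no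
regularity of `χ σ` is needed.  Proof (the determinant of Mok's argument; Gan–Gross–Prasad: the
determinant of a conjugate self-dual parameter of sign `b` and odd dimension has sign `b`): the
central character `ω` of `P` is conjugate self-dual
(`centralCharacter_apply_smul_mul_eq_one_of_isConjSelfDualAE`) and trivial on `𝕀_F`
(`restrict_centralCharacter_eq_one_of_isWeakBaseChange`), so at the place `w` of `σ`,
`e^{2πi ∑ χ(σ_w)} = ω((-1)_w) = ω|_{𝕀_F}((-1)_v) = 1`
(`sum_archParameter_conjugate_and_centralCharacter_neg_one`,
`ideleBaseChange_infiniteIdeleSingle_neg_one_of_isConj`): `s = ∑ χ(σ) ∈ ℤ`; the integral pairing of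
the infinity type and `χ(σ̄) = -\overline{χ(σ)}`
(`archParameter_conjugate_eq_map_neg_conj_of_isConjSelfDualAE`) give `2r ∈ ℤ`; `s = N r + ℤ` gives
`N r ∈ ℤ`; and `r = N r - ((N-1)/2)(2 r) ∈ ℤ` as `N` is odd.
[cite: Mok2014, Cor. 2.5.5 with Thm. 2.4.10, Lemma 2.2.1, Thm. 2.4.2 and the Remark after Thm. 2.5.4, arXiv pp. 8, 13, 16, 20–21]
[cite: GanGrossPrasad2012, §3 (paragraph before Lemma 3.4: det M is conjugate-dual of sign b^dim M) and Lemma 3.4] [cite: Clozel1990, §3.3 and Lemme 4.9] -/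
theorem Mok2014_archimedean_parity_of_asaiSign_odd_pos_of_isWeakBaseChange
    (h2 : Module.finrank F E = 2) {c : E ≃ₐ[F] E} (hc : c ≠ 1) (hN : Odd N)
    (P : CuspidalAutomorphicRepData N E hcpt) (hcsd : P.1.IsConjSelfDualAE c)
    {π : UnitaryGroupAutomorphicRep F E c N hcpt}
    (hBC : UnitaryGroup.IsWeakBaseChange F E c N hcpt P.1 π) (hex : P.1.exists_hasInfinityType)
    {χ : (E →+* ℂ) → Multiset ℂ} (hχ : P.1.HasArchParameter χ)
    {σ : E →+* ℂ} (hσ : NumberField.ComplexEmbedding.IsConj σ c) {r : ℝ}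
    (hcos : ∀ a ∈ χ σ, ∃ m : ℤ, a = (m : ℂ) + (r : ℂ)) :
    ∀ a ∈ χ σ, ∃ m : ℤ, a = (m : ℂ) + ((N : ℂ) - 1) / 2 := by
  haveI : NeZero N := ⟨hN.pos.ne'⟩
  -- the place `w₀` of `σ`: complex, fixed by `c`
  have hram : ¬ IsUnramified F (InfinitePlace.mk σ) := fun h => hc (hσ.isUnramified_mk_iff.1 h)
  have hw : (InfinitePlace.mk σ).IsComplex := (not_isUnramified_iff.1 hram).1
  set w₀ : {w : InfinitePlace E // w.IsComplex} := ⟨InfinitePlace.mk σ, hw⟩ with hw₀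
  have hcw : c • w₀.1 = w₀.1 :=
    MulAction.mem_stabilizer_iff.1 ((NumberField.InfinitePlace.mem_stabilizer_mk_iff σ c).2 (Or.inr hσ))
  -- the central character: conjugate self-dual and trivial on `𝕀_F`
  obtain ⟨ω, hωc, hωs⟩ := P.1.exists_centralCharacter
  have hdual : ∀ y : ideleGroup E, ω (c • y) * ω y = 1 :=
    P.1.centralCharacter_apply_smul_mul_eq_one_of_isConjSelfDualAE (fun h => hωs h) hcsd
  obtain ⟨ψ, hψ⟩ := ω.exists_restrict F
  have hψ1 : ψ = 1 :=
    P.1.restrict_centralCharacter_eq_one_of_isWeakBaseChange h2 hc (fun h => hωs h) hcsd hBC hψ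
  -- the centre at `w₀`: `e^{2πi p} = ω((-1)_{w₀}) = ψ((-1)_v) = 1`, `p = ∑ χ(σ_{w₀}) ∈ ℤ`, `q = -p`
  obtain ⟨hsum, hneg⟩ :=
    P.1.sum_archParameter_conjugate_and_centralCharacter_neg_one hc hωc hdual hχ w₀ hcw
  obtain ⟨-, -, hbc⟩ := ideleBaseChange_infiniteIdeleSingle_neg_one_of_isConj h2 hc hσ
  have hone : Complex.exp (2 * Real.pi * Complex.I * (χ w₀.1.embedding).sum) = 1 := by
    rw [← hneg, show w₀.1 = InfinitePlace.mk σ from rfl, ← hbc, ← hψ, hψ1, HeckeCharacter.one_apply,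
      Units.val_one]
  obtain ⟨k, hk⟩ := Complex.exp_eq_one_iff.1 hone
  have hpk : (χ w₀.1.embedding).sum = k := by
    have h2pi0 : (2 * Real.pi * Complex.I : ℂ) ≠ 0 := by simp [Real.pi_ne_zero, Complex.I_ne_zero]
    exact mul_left_cancel₀ h2pi0 (by rw [hk, mul_comm])
  -- `s = ∑ χ(σ)` is an integer (`σ = σ_{w₀}` or `σ̄_{w₀}`)
  have hs : ∃ k' : ℤ, (χ σ).sum = k' := by
    rcases InfinitePlace.mk_eq_iff.mp (InfinitePlace.mk_embedding (InfinitePlace.mk σ)) with h | h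
    · exact ⟨k, by rw [← h]; exact hpk⟩
    · exact ⟨-k, by rw [← h, Int.cast_neg, ← hpk]; exact hsum⟩
  obtain ⟨k', hk'⟩ := hs
  -- Clozel's symmetry with shift `0` at `σ`
  have hsymm : χ (ComplexEmbedding.conjugate σ) = (χ σ).map fun a => -conj a :=
    P.archParameter_conjugate_eq_map_neg_conj_of_isConjSelfDualAE hc hcsd hχ w₀ hcw σ
  -- the infinity type: `χ = (T ·).map a`, integral pairing
  obtain ⟨T, hTwf, hTχ⟩ := hex
  have hχT : χ = fun ι => (T ι).map ArchWeight.a := P.1.hasArchParameter_unique hχ hTχ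
  have hcardσ : Multiset.card (χ σ) = N := by rw [hχT, Multiset.card_map, hTwf.1 σ]
  -- `N r ∈ ℤ`
  obtain ⟨M, hM⟩ : ∃ M : ℤ, ((χ σ).map fun x => x - (r : ℂ)).sum = M := by
    refine exists_int_multiset_sum fun x hx => ?_
    obtain ⟨a, ha, rfl⟩ := Multiset.mem_map.1 hx
    obtain ⟨m, hm⟩ := hcos a ha
    exact ⟨m, by rw [hm, add_sub_cancel_right]⟩
  have hNr : (N : ℂ) * r = (k' : ℂ) - M := by
    rw [Multiset.sum_map_sub, Multiset.map_id', Multiset.map_const', Multiset.sum_replicate, hcardσ,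
      nsmul_eq_mul, hk'] at hM
    linear_combination -hM
  intro a ha
  obtain ⟨m, hm⟩ := hcos a ha
  -- `2 r ∈ ℤ`: `a` is paired with `b = a - m₁`, `m₁ ∈ ℤ`, and `b ∈ χ(σ̄) = -conj χ(σ) ⊆ -r + ℤ`
  obtain ⟨wt, hwt, hwta⟩ : ∃ wt ∈ T σ, wt.a = a := by
    rw [hχT] at ha
    exact Multiset.mem_map.1 ha
  have hb : wt.b ∈ χ (ComplexEmbedding.conjugate σ) := by
    rw [hχT]
    change wt.b ∈ (T (ComplexEmbedding.conjugate σ)).map ArchWeight.a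
    rw [hTwf.2 σ, Multiset.map_map]
    exact Multiset.mem_map.2 ⟨wt, hwt, rfl⟩
  rw [hsymm] at hb
  obtain ⟨a', ha', hba'⟩ := Multiset.mem_map.1 hb
  obtain ⟨m', hm'⟩ := hcos a' ha'
  obtain ⟨m₁, hm₁⟩ := wt.exists_int_sub
  have h2r : (2 : ℂ) * r = (m₁ : ℂ) - m - m' := by
    rw [hwta, ← hba', hm, hm', map_add, Complex.conj_ofReal, map_intCast] at hm₁
    linear_combination hm₁
  -- `N = 2 n + 1`: `r = N r - n (2 r) ∈ ℤ`
  obtain ⟨n, rfl⟩ := hN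
  refine ⟨m + (k' - M - n * (m₁ - m - m')) - n, ?_⟩
  rw [hm]
  push_cast at hNr ⊢
  linear_combination hNr - (n : ℂ) * h2r

/-- **The stratum "`N` odd, `κ = +1`" of `Mok2014_archimedean_parity_of_asaiSign` from the named
fact `Mok2014_standardBaseChange_descent`.**  With the fact's binders at `κ = 1` and `N` odd — whose
hypotheses `IsConjSelfDualAE c` and `HasAsaiSign c 1` (raw currency) are letter for letter those of
`Mok2014_standardBaseChange_descent` (Mok, Thm. 2.4.2 with Thm. 2.5.4 (a): descent to `U_{E/F}(N)`
along the standard embedding) — plus an infinity type of `P`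
(`AutomorphicRepData.exists_hasInfinityType`, Clozel 1990 §3.3) and minus the regularity hypothesis
`(χ σ).Nodup`: every exponent `a ∈ χ σ` lies in `(N-1)/2 + (1-κ)/4 + ℤ` (`= ℤ` here).  Proof: the
descent provides the weak base change and `Mok2014_archimedean_parity_of_asaiSign_odd_pos_of_isWeakBaseChange`
applies.  (The remaining strata of the fact — `κ = -1` with `N` odd, and `N` even — are not touched:
they need the twisted descent `ξ_{χ_-}`, resp. Mok's Thm. 2.4.10 at the archimedean place beyond
its determinant; cf. `Mok2014_archimedean_parity_of_asaiSign_of_facts`.)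
[cite: Mok2014, Thm. 2.4.2, Thm. 2.5.4 and Cor. 2.5.5 (arXiv pp. 13, 20–21)]
[cite: GanGrossPrasad2012, §3 (paragraph before Lemma 3.4: det M is conjugate-dual of sign b^dim M) and Lemma 3.4] -/
theorem Mok2014_archimedean_parity_of_asaiSign_odd_pos_of_standardBaseChange_descent
    (hdesc : Mok2014_standardBaseChange_descent)
    (F E : Type) [Field F] [NumberField F] [Field E] [NumberField E] [Algebra F E] (c : E ≃ₐ[F] E)
    (h2 : Module.finrank F E = 2) (hc : c ≠ 1) (N : ℕ) (hcpt : isCompact_glFiniteIntegralLevel N E)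
    (P : CuspidalAutomorphicRepData N E hcpt) (χ : (E →+* ℂ) → Multiset ℂ) (σ : E →+* ℂ) (r : ℝ)
    (hN : Odd N) (hcsd : P.1.IsConjSelfDualAE c) (hsign : P.1.HasAsaiSign c 1)
    (hχ : P.1.HasArchParameter χ) (hσ : NumberField.ComplexEmbedding.IsConj σ c)
    (hex : P.1.exists_hasInfinityType) (hcos : ∀ a ∈ χ σ, ∃ m : ℤ, a = (m : ℂ) + (r : ℂ)) :
    ∀ a ∈ χ σ, ∃ m : ℤ, a = (m : ℂ) + ((N : ℂ) - 1) / 2 + (1 - (((1 : ℤˣ) : ℤ) : ℂ)) / 4 := by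
  obtain ⟨π, hBC⟩ := hdesc F E c h2 hc N hcpt P hN.pos hcsd hsign
  intro a ha
  obtain ⟨m, hm⟩ := Mok2014_archimedean_parity_of_asaiSign_odd_pos_of_isWeakBaseChange h2 hc hN P
    hcsd hBC hex hχ hσ hcos a ha
  exact ⟨m, by rw [hm]; push_cast; ring⟩

/-- **`Mok2014_archimedean_parity_of_asaiSign` reduced to its strata "`N` even" and "`κ = -1`",
granted the standard descent and infinity types.**  If `Mok2014_standardBaseChange_descent` holds and
every cuspidal datum on `GL_N(𝔸_E)` has an infinity type (`AutomorphicRepData.exists_hasInfinityType`,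
Clozel 1990 §3.3), then the named fact follows from its own restriction to the data with `N` even
or `κ = -1` — the stratum `N` odd, `κ = +1` being
`Mok2014_archimedean_parity_of_asaiSign_odd_pos_of_standardBaseChange_descent` (and `N = 1` being the
theorem `Mok2014_archimedean_parity_of_asaiSign_rank_one` outright).
[cite: Mok2014, Thm. 2.4.2, Thm. 2.5.4 and Cor. 2.5.5] -/
theorem Mok2014_archimedean_parity_of_asaiSign_of_standardBaseChange_descent_of_even_or_neg
    (hdesc : Mok2014_standardBaseChange_descent)
    (hex : ∀ (E : Type) [Field E] [NumberField E] (N : ℕ) (hcpt : isCompact_glFiniteIntegralLevel N E)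
      (P : CuspidalAutomorphicRepData N E hcpt), P.1.exists_hasInfinityType)
    (hrest : ∀ (F E : Type) [Field F] [NumberField F] [Field E] [NumberField E] [Algebra F E]
      (c : E ≃ₐ[F] E), Module.finrank F E = 2 → c ≠ 1 →
      ∀ (N : ℕ) (hcpt : isCompact_glFiniteIntegralLevel N E) (P : CuspidalAutomorphicRepData N E hcpt)
        (κ : ℤˣ) (χ : (E →+* ℂ) → Multiset ℂ) (σ : E →+* ℂ) (r : ℝ),
        (Even N ∨ κ = -1) → 0 < N → P.1.IsConjSelfDualAE c → P.1.HasAsaiSign c κ →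
        P.1.HasArchParameter χ → NumberField.ComplexEmbedding.IsConj σ c → (χ σ).Nodup →
        (∀ a ∈ χ σ, ∃ m : ℤ, a = (m : ℂ) + (r : ℂ)) →
        ∀ a ∈ χ σ, ∃ m : ℤ, a = (m : ℂ) + ((N : ℂ) - 1) / 2 + (1 - ((κ : ℤ) : ℂ)) / 4) :
    Mok2014_archimedean_parity_of_asaiSign := by
  intro F E _ _ _ _ _ c h2 hc N hcpt P κ χ σ r hN hcsd hsign hχ hσ hnd hcos
  rcases Nat.even_or_odd N with hNe | hNo
  · exact hrest F E c h2 hc N hcpt P κ χ σ r (Or.inl hNe) hN hcsd hsign hχ hσ hnd hcos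
  · rcases Int.units_eq_one_or κ with rfl | rfl
    · exact Mok2014_archimedean_parity_of_asaiSign_odd_pos_of_standardBaseChange_descent hdesc F E c h2
        hc N hcpt P χ σ r hNo hcsd hsign hχ hσ (hex E N hcpt P) hcos
    · exact hrest F E c h2 hc N hcpt P (-1) χ σ r (Or.inr rfl) hN hcsd hsign hχ hσ hnd hcos

/-- **A conjugate self-dual cuspidal representation of odd rank with non-integral exponents at a
`c`-conjugation place is not a standard weak base change from `U_{E/F}(N)`** (contrapositive, and
currency-free, form of `Mok2014_archimedean_parity_of_asaiSign_odd_pos_of_isWeakBaseChange`): for `N`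
odd, `P` cuspidal on `GL_N(𝔸_E)` conjugate self-dual a.e. with an infinity type, `σ` with `c` acting
as complex conjugation, and the exponents `χ σ` in a real coset `r + ℤ` with `r ∉ ℤ` (e.g.
`r = 1/2`: the cohomological / unitary-Shimura-variety case of Mok's Cor. 2.5.5 for odd `N` has
`a_i ∈ (N+1)/2 + ℤ = ℤ`, so this is the COMPLEMENTARY case), no automorphic representation `π` of
`U_{E/F}(N)(𝔸_F)` has `P` as its standard weak base change.  With Mok's Thm. 2.4.2 (in any currency:
"`κ = +1` iff standard base change") this pins `κ(P) = -1` — the odd-rank half of the archimedean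
sign pin — without Thm. 2.4.10 at the archimedean place.
[cite: Mok2014, Thm. 2.4.2, Remark after Thm. 2.5.4 and Cor. 2.5.5 (arXiv pp. 13, 21)]
[cite: GanGrossPrasad2012, §3 (paragraph before Lemma 3.4: det M is conjugate-dual of sign b^dim M) and Lemma 3.4] -/
theorem CuspidalAutomorphicRepData.not_isWeakBaseChange_of_odd_of_coset
    (h2 : Module.finrank F E = 2) {c : E ≃ₐ[F] E} (hc : c ≠ 1) (hN : Odd N)
    (P : CuspidalAutomorphicRepData N E hcpt) (hcsd : P.1.IsConjSelfDualAE c)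
    (hex : P.1.exists_hasInfinityType) {χ : (E →+* ℂ) → Multiset ℂ} (hχ : P.1.HasArchParameter χ)
    {σ : E →+* ℂ} (hσ : NumberField.ComplexEmbedding.IsConj σ c) {r : ℝ}
    (hcos : ∀ a ∈ χ σ, ∃ m : ℤ, a = (m : ℂ) + (r : ℂ)) (hr : ∀ m : ℤ, (r : ℝ) ≠ m)
    (π : UnitaryGroupAutomorphicRep F E c N hcpt) :
    ¬ UnitaryGroup.IsWeakBaseChange F E c N hcpt P.1 π := by
  intro hBC
  -- an exponent exists: `card (χ σ) = N > 0`
  have hcard : Multiset.card (χ σ) = N := card_eq_of_hasArchParameter' hχ σ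
  obtain ⟨a, ha⟩ : ∃ a, a ∈ χ σ := Multiset.card_pos_iff_exists_mem.mp (hcard ▸ hN.pos)
  obtain ⟨m, hm⟩ := Mok2014_archimedean_parity_of_asaiSign_odd_pos_of_isWeakBaseChange h2 hc hN P hcsd
    hBC hex hχ hσ hcos a ha
  obtain ⟨m', hm'⟩ := hcos a ha
  obtain ⟨n, rfl⟩ := hN
  refine hr (m - m' + n) ?_
  have h : (r : ℂ) = ((m - m' + n : ℤ) : ℂ) := by
    push_cast at hm ⊢
    linear_combination hm - hm'
  exact_mod_cast h

/-- **For odd `N`, non-integral exponents exclude the raw Asai sign `+1`**, granted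
`Mok2014_standardBaseChange_descent`: in the setting of
`not_isWeakBaseChange_of_odd_of_coset` (`N` odd, `P` conjugate self-dual cuspidal with an infinity
type, `σ` a `c`-conjugation embedding, exponents in `r + ℤ` with `r ∉ ℤ`), `¬ P.HasAsaiSign c 1`, i.e.
the raw partial Asai product `L^S(s, P, As⁺)` does not have the pole at `s = 1⁺` at every Asai datum
(the descent would make `P` a standard weak base change).
[cite: Mok2014, Thm. 2.4.2, Thm. 2.5.4 (a) and Cor. 2.5.5 (arXiv pp. 13, 20–21)] -/
theorem CuspidalAutomorphicRepData.not_hasAsaiSign_one_of_odd_of_coset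
    (hdesc : Mok2014_standardBaseChange_descent)
    (h2 : Module.finrank F E = 2) {c : E ≃ₐ[F] E} (hc : c ≠ 1) (hN : Odd N)
    (P : CuspidalAutomorphicRepData N E hcpt) (hcsd : P.1.IsConjSelfDualAE c)
    (hex : P.1.exists_hasInfinityType) {χ : (E →+* ℂ) → Multiset ℂ} (hχ : P.1.HasArchParameter χ)
    {σ : E →+* ℂ} (hσ : NumberField.ComplexEmbedding.IsConj σ c) {r : ℝ}
    (hcos : ∀ a ∈ χ σ, ∃ m : ℤ, a = (m : ℂ) + (r : ℂ)) (hr : ∀ m : ℤ, (r : ℝ) ≠ m) :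
    ¬ P.1.HasAsaiSign c 1 := by
  intro hsign
  obtain ⟨π, hBC⟩ := hdesc F E c h2 hc N hcpt P hN.pos hcsd hsign
  exact P.not_isWeakBaseChange_of_odd_of_coset h2 hc hN hcsd hex hχ hσ hcos hr π hBC

/-! ### Without infinity types: the centre needs only `2r ∈ ℤ` (e.g. exponents in `1/2 + ℤ`) -/

/-- **The centre of Mok's Cor. 2.5.5 for odd `N`, with `2r ∈ ℤ` in place of an infinity type.**  Same
setting as `Mok2014_archimedean_parity_of_asaiSign_odd_pos_of_isWeakBaseChange` (`N` odd, `P` cuspidal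
conjugate self-dual a.e., a standard weak base change from `U_{E/F}(N)`, `σ` a `c`-conjugation
embedding, exponents `χ σ ⊆ r + ℤ`), but instead of an infinity type of `P` we only ask `2r ∈ ℤ` —
which is all the integral pairing was used for, and which holds trivially in the half-integral case
`r = 1/2` of the applications (no appeal to the Langlands classification of `GL_N(ℂ)`).  Conclusion:
every exponent is an integer (`∈ (N-1)/2 + ℤ`).  Proof: `∑ χ(σ) ∈ ℤ` by the centre
(`restrict_centralCharacter_eq_one_of_isWeakBaseChange`,
`sum_archParameter_conjugate_and_centralCharacter_neg_one`), `∑ χ(σ) = N r + ℤ` (`card χ(σ) = N`),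
and `r = N r - ((N-1)/2)(2r)`.
[cite: Mok2014, Cor. 2.5.5 with Thm. 2.4.2 and the Remark after Thm. 2.5.4, arXiv pp. 13, 20–21]
[cite: GanGrossPrasad2012, §3 (paragraph before Lemma 3.4: det M is conjugate-dual of sign b^dim M) and Lemma 3.4] -/
theorem Mok2014_archimedean_parity_of_asaiSign_odd_pos_of_isWeakBaseChange_of_two_mul
    (h2 : Module.finrank F E = 2) {c : E ≃ₐ[F] E} (hc : c ≠ 1) (hN : Odd N)
    (P : CuspidalAutomorphicRepData N E hcpt) (hcsd : P.1.IsConjSelfDualAE c)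
    {π : UnitaryGroupAutomorphicRep F E c N hcpt}
    (hBC : UnitaryGroup.IsWeakBaseChange F E c N hcpt P.1 π)
    {χ : (E →+* ℂ) → Multiset ℂ} (hχ : P.1.HasArchParameter χ)
    {σ : E →+* ℂ} (hσ : NumberField.ComplexEmbedding.IsConj σ c) {r : ℝ}
    (hcos : ∀ a ∈ χ σ, ∃ m : ℤ, a = (m : ℂ) + (r : ℂ)) (h2r : ∃ k : ℤ, 2 * r = k) :
    ∀ a ∈ χ σ, ∃ m : ℤ, a = (m : ℂ) + ((N : ℂ) - 1) / 2 := by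
  -- the place `w₀` of `σ`: complex, fixed by `c`
  have hram : ¬ IsUnramified F (InfinitePlace.mk σ) := fun h => hc (hσ.isUnramified_mk_iff.1 h)
  have hw : (InfinitePlace.mk σ).IsComplex := (not_isUnramified_iff.1 hram).1
  set w₀ : {w : InfinitePlace E // w.IsComplex} := ⟨InfinitePlace.mk σ, hw⟩ with hw₀
  have hcw : c • w₀.1 = w₀.1 :=
    MulAction.mem_stabilizer_iff.1 ((NumberField.InfinitePlace.mem_stabilizer_mk_iff σ c).2 (Or.inr hσ))
  -- the central character: conjugate self-dual and trivial on `𝕀_F`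
  obtain ⟨ω, hωc, hωs⟩ := P.1.exists_centralCharacter
  have hdual : ∀ y : ideleGroup E, ω (c • y) * ω y = 1 :=
    P.1.centralCharacter_apply_smul_mul_eq_one_of_isConjSelfDualAE (fun h => hωs h) hcsd
  obtain ⟨ψ, hψ⟩ := ω.exists_restrict F
  have hψ1 : ψ = 1 :=
    P.1.restrict_centralCharacter_eq_one_of_isWeakBaseChange h2 hc (fun h => hωs h) hcsd hBC hψ
  -- the centre at `w₀`
  obtain ⟨hsum, hneg⟩ :=
    P.1.sum_archParameter_conjugate_and_centralCharacter_neg_one hc hωc hdual hχ w₀ hcw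
  obtain ⟨-, -, hbc⟩ := ideleBaseChange_infiniteIdeleSingle_neg_one_of_isConj h2 hc hσ
  have hone : Complex.exp (2 * Real.pi * Complex.I * (χ w₀.1.embedding).sum) = 1 := by
    rw [← hneg, show w₀.1 = InfinitePlace.mk σ from rfl, ← hbc, ← hψ, hψ1, HeckeCharacter.one_apply,
      Units.val_one]
  obtain ⟨k, hk⟩ := Complex.exp_eq_one_iff.1 hone
  have hpk : (χ w₀.1.embedding).sum = k := by
    have h2pi0 : (2 * Real.pi * Complex.I : ℂ) ≠ 0 := by simp [Real.pi_ne_zero, Complex.I_ne_zero]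
    exact mul_left_cancel₀ h2pi0 (by rw [hk, mul_comm])
  -- `s = ∑ χ(σ) ∈ ℤ`
  obtain ⟨k', hk'⟩ : ∃ k' : ℤ, (χ σ).sum = k' := by
    rcases InfinitePlace.mk_eq_iff.mp (InfinitePlace.mk_embedding (InfinitePlace.mk σ)) with h | h
    · exact ⟨k, by rw [← h]; exact hpk⟩
    · exact ⟨-k, by rw [← h, Int.cast_neg, ← hpk]; exact hsum⟩
  -- `N r ∈ ℤ`
  have hcardσ : Multiset.card (χ σ) = N := card_eq_of_hasArchParameter' hχ σ
  obtain ⟨M, hM⟩ : ∃ M : ℤ, ((χ σ).map fun x => x - (r : ℂ)).sum = M := by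
    refine exists_int_multiset_sum fun x hx => ?_
    obtain ⟨a, ha, rfl⟩ := Multiset.mem_map.1 hx
    obtain ⟨m, hm⟩ := hcos a ha
    exact ⟨m, by rw [hm, add_sub_cancel_right]⟩
  have hNr : (N : ℂ) * r = (k' : ℂ) - M := by
    rw [Multiset.sum_map_sub, Multiset.map_id', Multiset.map_const', Multiset.sum_replicate, hcardσ,
      nsmul_eq_mul, hk'] at hM
    linear_combination -hM
  -- `2 r ∈ ℤ`, `N = 2 n + 1`: `r = N r - n (2 r) ∈ ℤ`
  obtain ⟨k₂, hk₂⟩ := h2r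
  have h2r' : (2 : ℂ) * r = (k₂ : ℂ) := by exact_mod_cast hk₂
  intro a ha
  obtain ⟨m, hm⟩ := hcos a ha
  obtain ⟨n, rfl⟩ := hN
  refine ⟨m + (k' - M - n * k₂) - n, ?_⟩
  rw [hm]
  push_cast at hNr ⊢
  linear_combination hNr - (n : ℂ) * h2r'

/-- **Odd rank, exponents in `1/2 + ℤ`: not a standard weak base change from `U_{E/F}(N)`** — with no
infinity-type hypothesis.  For `N` odd, `P` cuspidal on `GL_N(𝔸_E)` conjugate self-dual a.e., `σ` a
`c`-conjugation embedding and every exponent of `χ σ` in `1/2 + ℤ` (Mok's Cor. 2.5.5 case for EVEN `N`;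
for odd `N` it is the complementary coset), no automorphic representation `π` of `U_{E/F}(N)(𝔸_F)` has
`P` as its standard weak base change (`2 · (1/2) = 1 ∈ ℤ` feeds
`Mok2014_archimedean_parity_of_asaiSign_odd_pos_of_isWeakBaseChange_of_two_mul`, whose conclusion
`a ∈ ℤ` contradicts `a ∈ 1/2 + ℤ`; `χ σ ≠ ∅` as `card χ(σ) = N`).  With Mok's Thm. 2.4.2 ("`κ = +1` iff
standard base change", any currency) this pins `κ = -1`, i.e. `P` conjugate symplectic — the odd-rank
half of the archimedean sign pin (`Mok2014_archimedean_parity_of_asaiSign(Cont)`) free of Thm. 2.4.10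
at the archimedean place and of the Langlands classification of `GL_N(ℂ)`.
[cite: Mok2014, Thm. 2.4.2, Remark after Thm. 2.5.4 and Cor. 2.5.5 (arXiv pp. 13, 21)]
[cite: GanGrossPrasad2012, §3 (paragraph before Lemma 3.4: det M is conjugate-dual of sign b^dim M) and Lemma 3.4] -/
theorem CuspidalAutomorphicRepData.not_isWeakBaseChange_of_odd_of_mem_half
    (h2 : Module.finrank F E = 2) {c : E ≃ₐ[F] E} (hc : c ≠ 1) (hN : Odd N)
    (P : CuspidalAutomorphicRepData N E hcpt) (hcsd : P.1.IsConjSelfDualAE c)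
    {χ : (E →+* ℂ) → Multiset ℂ} (hχ : P.1.HasArchParameter χ)
    {σ : E →+* ℂ} (hσ : NumberField.ComplexEmbedding.IsConj σ c)
    (hhalf : ∀ a ∈ χ σ, ∃ m : ℤ, a = (m : ℂ) + 1 / 2)
    (π : UnitaryGroupAutomorphicRep F E c N hcpt) :
    ¬ UnitaryGroup.IsWeakBaseChange F E c N hcpt P.1 π := by
  intro hBC
  have hcos : ∀ a ∈ χ σ, ∃ m : ℤ, a = (m : ℂ) + ((1 / 2 : ℝ) : ℂ) := fun a ha => by
    obtain ⟨m, hm⟩ := hhalf a ha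
    exact ⟨m, by rw [hm]; push_cast; ring⟩
  have hcard : Multiset.card (χ σ) = N := card_eq_of_hasArchParameter' hχ σ
  obtain ⟨a, ha⟩ : ∃ a, a ∈ χ σ := Multiset.card_pos_iff_exists_mem.mp (hcard ▸ hN.pos)
  obtain ⟨m, hm⟩ := Mok2014_archimedean_parity_of_asaiSign_odd_pos_of_isWeakBaseChange_of_two_mul h2 hc
    hN P hcsd hBC hχ hσ hcos ⟨1, by norm_num⟩ a ha
  obtain ⟨m', hm'⟩ := hhalf a ha
  obtain ⟨n, rfl⟩ := hN
  -- `m' + 1/2 = m + n`: impossible in `ℤ`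
  have h : (2 : ℂ) * ((m : ℂ) + n - m') = 1 := by
    push_cast at hm
    linear_combination 2 * (hm' - hm)
  have h' : (2 : ℤ) * (m + n - m') = 1 := by exact_mod_cast h
  omega

/-- **Odd rank, exponents in `1/2 + ℤ`: the raw Asai sign is not `+1`**, granted
`Mok2014_standardBaseChange_descent` (the descent would make `P` a standard weak base change, excluded by
`not_isWeakBaseChange_of_odd_of_mem_half`); no infinity-type hypothesis.
[cite: Mok2014, Thm. 2.4.2, Thm. 2.5.4 (a) and Cor. 2.5.5 (arXiv pp. 13, 20–21)] -/
theorem CuspidalAutomorphicRepData.not_hasAsaiSign_one_of_odd_of_mem_half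
    (hdesc : Mok2014_standardBaseChange_descent)
    (h2 : Module.finrank F E = 2) {c : E ≃ₐ[F] E} (hc : c ≠ 1) (hN : Odd N)
    (P : CuspidalAutomorphicRepData N E hcpt) (hcsd : P.1.IsConjSelfDualAE c)
    {χ : (E →+* ℂ) → Multiset ℂ} (hχ : P.1.HasArchParameter χ)
    {σ : E →+* ℂ} (hσ : NumberField.ComplexEmbedding.IsConj σ c)
    (hhalf : ∀ a ∈ χ σ, ∃ m : ℤ, a = (m : ℂ) + 1 / 2) : ¬ P.1.HasAsaiSign c 1 := by
  intro hsign
  obtain ⟨π, hBC⟩ := hdesc F E c h2 hc N hcpt P hN.pos hcsd hsign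
  exact P.not_isWeakBaseChange_of_odd_of_mem_half h2 hc hN hcsd hχ hσ hhalf π hBC

end OddPositive

/-! ### Unconditionally: `∑ χ(σ) ∈ ℤ` or `∈ 1/2 + ℤ` according as `ω|_{𝕀_F} = 1` or `= ω_{E/F}` -/

section Dichotomy

variable {F E : Type} [Field F] [NumberField F] [Field E] [NumberField E] [Algebra F E]
  {N : ℕ} {hcpt : isCompact_glFiniteIntegralLevel N E}

/-- **The centre of a conjugate self-dual representation, unconditionally: `∑ χ(σ)` is an integer or a
half-integer according as `ω|_{𝕀_F}` is trivial or the class-field character.**  Let `P = W / W'` be an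
automorphic representation of `GL_N(𝔸_E)` (`E/F` quadratic, `c ≠ 1`) conjugate self-dual a.e., `ω` a
Hecke character through which the centre acts, carrying the Satake shadow
(`AutomorphicRepData.exists_centralCharacter`), `ψ = ω|_{𝕀_F}`, `χ` the archimedean parameter and `σ`
an embedding on which `c` is complex conjugation, over the real place `v` of `F`.  Then: `ψ` is trivial
on the norm group `F^× N_{E/F} 𝕀_E` (`ω(c • y) ω(y) = 1`,
`centralCharacter_apply_smul_mul_eq_one_of_isConjSelfDualAE`), so `ψ ∈ {1, ω_{E/F}}` (norm index two);
and `e^{2πi ∑ χ(σ)} = ω((-1)_w) = ψ_v(-1)` (`sum_archParameter_conjugate_and_centralCharacter_neg_one`),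
which is `+1` if `ψ = 1` and `-1` if `ψ ≠ 1` (`ψ = ω_{E/F}` and `ω_{E/F, v}(-1) = -1` at a real place
under a complex one, `HeckeCharacter.archComponent_neg_one_eq_of_isTrivialOnNormGroup`): **`ψ = 1 ⇒
∑ χ(σ) ∈ ℤ`, `ψ ≠ 1 ⇒ ∑ χ(σ) ∈ 1/2 + ℤ`.**  (Gan–Gross–Prasad, Lemma 3.4 for the determinant
character `ω`: conjugate-orthogonal iff trivial on `k₀ˣ`; Mok §2.1 p. 7, `𝒵_E = 𝒵_E^+ ⊔ 𝒵_E^-` and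
(2.1.8).  For odd `N` Mok's Thm. 2.4.2 makes the two cases `κ = ±1`; the case `ψ = 1` along a standard
weak base change is `Mok2014_archimedean_parity_of_asaiSign_odd_pos_of_isWeakBaseChange_of_two_mul`.)
[cite: GanGrossPrasad2012, Lemma 3.4] [cite: Mok2014, §2.1 (2.1.4)–(2.1.8), arXiv p. 7]
[cite: CasselsFrohlichANT1967, Ch. VII §5.1 Main Theorem (B) and §6.3–6.4] -/
theorem AutomorphicRepData.sum_archParameter_int_or_half_of_isConjSelfDualAE
    (h2 : Module.finrank F E = 2) {c : E ≃ₐ[F] E} (hc : c ≠ 1)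
    (P : AutomorphicRepData (AutomorphyDatum.gl N E hcpt)) {ω : HeckeCharacter E}
    (hωc : ∀ (z : ideleGroup E), ∀ φ ∈ P.W, rightTranslation (AdelicGroupData.gl N E)
      (Matrix.GeneralLinearGroup.scalar (Fin N) z) φ - ((ω z : ℂˣ) : ℂ) • φ ∈ P.W')
    (hωs : ∀ {w : HeightOneSpectrum (𝓞 E)} {α : Multiset ℂ}, P.HasSatakeParamAt w α →
      ω.IsUnramifiedAt w ∧ ω.valueAtUniformizer w = α.prod)
    (hcsd : P.IsConjSelfDualAE c)
    {ψ : HeckeCharacter F} (hψ : ∀ x, ψ x = ω (AdeleRing.ideleBaseChange F E x))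
    {χ : (E →+* ℂ) → Multiset ℂ} (hχ : P.HasArchParameter χ)
    {σ : E →+* ℂ} (hσ : NumberField.ComplexEmbedding.IsConj σ c) :
    ψ.IsTrivialOnNormGroup E ∧
      (ψ = 1 → ∃ k : ℤ, (χ σ).sum = k) ∧ (ψ ≠ 1 → ∃ k : ℤ, (χ σ).sum = k + 1 / 2) := by
  -- the place `w₀` of `σ`: complex, fixed by `c`, alone above the real place `v`
  have hram : ¬ IsUnramified F (InfinitePlace.mk σ) := fun h => hc (hσ.isUnramified_mk_iff.1 h)
  have hw : (InfinitePlace.mk σ).IsComplex := (not_isUnramified_iff.1 hram).1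
  set w₀ : {w : InfinitePlace E // w.IsComplex} := ⟨InfinitePlace.mk σ, hw⟩ with hw₀
  have hcw : c • w₀.1 = w₀.1 :=
    MulAction.mem_stabilizer_iff.1 ((NumberField.InfinitePlace.mem_stabilizer_mk_iff σ c).2 (Or.inr hσ))
  have hdual : ∀ y : ideleGroup E, ω (c • y) * ω y = 1 :=
    P.centralCharacter_apply_smul_mul_eq_one_of_isConjSelfDualAE (fun h => hωs h) hcsd
  have hψN : ψ.IsTrivialOnNormGroup E :=
    HeckeCharacter.isTrivialOnNormGroup_restrict_of_apply_smul_mul h2 hc hdual hψ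
  -- `e^{2πi p} = ω((-1)_{w₀}) = ψ_v(-1)`, `p = ∑ χ(σ_{w₀})`, and `∑ χ(σ̄_{w₀}) = -p`
  obtain ⟨hsum, hneg⟩ :=
    P.sum_archParameter_conjugate_and_centralCharacter_neg_one hc hωc hdual hχ w₀ hcw
  obtain ⟨hv, huniq, hbc⟩ := ideleBaseChange_infiniteIdeleSingle_neg_one_of_isConj h2 hc hσ
  have hψv : ((ψ.archComponent ((InfinitePlace.mk σ).comap (algebraMap F E)) (-1) : ℂˣ) : ℂ) =
      Complex.exp (2 * Real.pi * Complex.I * (χ w₀.1.embedding).sum) := by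
    rw [HeckeCharacter.archComponent_apply, hψ, hbc, ← hneg]
  -- from `e^{2πi p} = e^{2πi t}` (`t = 0` or `1/2`) to `∑ χ(σ) ∈ t + ℤ` (`σ = σ_{w₀}` or `σ̄_{w₀}`)
  have key : ∀ t : ℝ, 2 * t = (⌊2 * t⌋ : ℝ) →
      Complex.exp (2 * Real.pi * Complex.I * (χ w₀.1.embedding).sum) =
        Complex.exp (2 * Real.pi * Complex.I * t) → ∃ k : ℤ, (χ σ).sum = k + t := by
    intro t ht h
    rw [Complex.exp_eq_exp_iff_exists_int] at h
    obtain ⟨k, hk⟩ := h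
    have h2pi0 : (2 * Real.pi * Complex.I : ℂ) ≠ 0 := by simp [Real.pi_ne_zero, Complex.I_ne_zero]
    have hpk : (χ w₀.1.embedding).sum = t + k := by
      refine mul_left_cancel₀ h2pi0 ?_
      rw [hk]
      ring
    rcases InfinitePlace.mk_eq_iff.mp (InfinitePlace.mk_embedding (InfinitePlace.mk σ)) with h | h
    · exact ⟨k, by rw [← h, hpk, add_comm]⟩
    · refine ⟨-k - ⌊2 * t⌋, ?_⟩
      rw [← h, hsum, hpk]
      have ht' : (2 : ℂ) * t = ((⌊2 * t⌋ : ℤ) : ℂ) := by exact_mod_cast ht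
      push_cast
      linear_combination (-1 : ℂ) * ht'
  refine ⟨hψN, fun hψ1 => ?_, fun hψ1 => ?_⟩
  · -- `ψ = 1`: `e^{2πi p} = 1 = e^{2πi · 0}`
    obtain ⟨k, hk⟩ := key 0 (by simp) (by
      rw [← hψv, hψ1, HeckeCharacter.archComponent_one, MonoidHom.one_apply, Units.val_one,
        Complex.ofReal_zero, mul_zero, Complex.exp_zero])
    exact ⟨k, by rw [hk, Complex.ofReal_zero, add_zero]⟩
  · -- `ψ ≠ 1`: `ψ = ω_{E/F}`, `ψ_v(-1) = -1 = e^{2πi · (1/2)}`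
    have hE : ∀ w : InfinitePlace E, w.comap (algebraMap F E) =
        (InfinitePlace.mk σ).comap (algebraMap F E) → ¬ w.IsReal := fun w hw' => by
      rw [huniq w hw']
      exact not_isReal_iff_isComplex.2 hw
    have h := HeckeCharacter.archComponent_neg_one_eq_of_isTrivialOnNormGroup h2 hψN hψ1 hv hE
    obtain ⟨k, hk⟩ := key (1 / 2) (by norm_num) (by
      rw [← hψv, h, Units.val_neg, Units.val_one,
        show (2 * Real.pi * Complex.I * ((1 / 2 : ℝ) : ℂ) : ℂ) = Real.pi * Complex.I by push_cast; ring,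
        Complex.exp_pi_mul_I])
    exact ⟨k, by rw [hk]; push_cast; ring⟩

end Dichotomy

end Literature.NumberTheory.Automorphic
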